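import Literature.Analysis.FluidPDE.LatticeShearWords
import Literature.Algebra.EuclideanLattices.FccBccLattices

/-!
# AnomalousDissipation / SolenoidalFractalHomogenisation — the isotropic cubature word (K2Q first rung)

Route `AnomalousDissipation/SolenoidalFractalHomogenisation`, crux `QuasiStaticSolenoidalCellTensorQ`
(stmt-AnomalousDissipation-19072), registered skeleton stub `stub_isotropicDesign`:

  `∃ k, ∃ W : LatticeShear.LatticeWord k, ∃ c₀ > 0, LatticeShear.IsotropicWordGain W c₀`.

WITNESS (cell `ad-ideate`, seat ad-p1, ROUND-2 Lemma 1.3 + erratum 2026-08-25): the 26-slot word playing, for each of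
the 13 lattice directions `m` ∈ {3 axes, 6 face diagonals, 4 body diagonals}, BOTH unit polarisations of an orthonormal
frame `{v/√n, v'/√n', m/|m|}`, with slot durations `τ_m = c_m |m|⁴`, `c = 40 : 32 : 27` (the degree-7 26-point cubature
weights on the sphere).  For unit `q`, unit `p ⊥ q` each slot contributes
`τ (e·q)² (1 − (m·p)²/|m|²) / (2 (2π|m|)⁴)` (lemma `slotGain_mkPhase`), the two polarisations of one direction add up to
`c_m (|q|² − (m̂·q)²)(1 − (m̂·p)²)/(32π⁴)` (frame completeness), and the second / fourth moment identities of the cubature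
(`Σ c_m (m̂·q)² = 140|q|²`, `Σ c_m (m̂·q)²(m̂·p)² = 28(|q|²|p|² + 2(q·p)²)`) make the slot sum the POLYNOMIAL
`(280|q|² − 112|q|²|p|² + 56(p·q)²)/(32π⁴)` (lemma `slotSum_eq`, by `ring` over the 26 explicit slots), hence
`= 168/(32π⁴) = 21/(4π⁴) = c₀ · period` with `period = 3720`, `c₀ = 7/(4960 π⁴) = 1.4488…e-5` (the constant of record).
No analysis: finite-dimensional real algebra only.
-/

set_option linter.dupNamespace false

namespace Summit.AnomalousDissipation.AnomalousDissipation.Theorems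

open Literature.Analysis Literature.Analysis.FunctionSpaces Literature.Analysis.FluidPDE
open Literature.Analysis.FluidPDE.LatticeShear
open scoped InnerProductSpace Real

noncomputable section

-- coordinates on `ℝ³`: `Literature.Algebra.EuclideanLattices.inner_fin_three` / `norm_sq_fin_three` (landed, FccBccLattices).
open Literature.Algebra.EuclideanLattices (inner_fin_three norm_sq_fin_three)

/-- Integer data of one slot: lattice vector `m`, polarisation numerator `v` with `|v|² = n`, slot duration `τ`. -/
structure SlotData where
  m : Fin 3 → ℤ
  v : Fin 3 → ℤ
  n : ℕ
  τ : ℕ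

/-- Admissibility of slot data: `m ≠ 0`, `0 < n = |v|²`, `v ⊥ m`, `0 < τ` (all decidable integer arithmetic). -/
def SlotData.ok (d : SlotData) : Prop :=
  (d.m 0 ≠ 0 ∨ d.m 1 ≠ 0 ∨ d.m 2 ≠ 0) ∧ 0 < d.n ∧ d.v 0 ^ 2 + d.v 1 ^ 2 + d.v 2 ^ 2 = (d.n : ℤ) ∧
    d.v 0 * d.m 0 + d.v 1 * d.m 1 + d.v 2 * d.m 2 = 0 ∧ 0 < d.τ

/-- The lattice phase of admissible slot data: polarisation `e = v/√n`, phase `0`. -/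
def mkPhase (d : SlotData) (h : d.ok) : LatticePhase where
  m := d.m
  e := (1 / Real.sqrt d.n) • Torus.latticeVec d.v
  τ := d.τ
  φ := 0
  m_ne := by
    intro hm
    rcases h.1 with h0 | h0 | h0 <;> exact h0 (by rw [hm]; rfl)
  e_unit := by
    have hn : (0 : ℝ) < d.n := by exact_mod_cast h.2.1
    have hv : ‖Torus.latticeVec d.v‖ = Real.sqrt d.n := by
      rw [← Real.sqrt_sq (norm_nonneg _), norm_sq_fin_three]
      congr 1
      have := h.2.2.1
      simp only [Torus.latticeVec_apply]
      exact_mod_cast this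
    rw [norm_smul, hv, Real.norm_eq_abs, abs_of_pos (by positivity), one_div,
      inv_mul_cancel₀ (Real.sqrt_pos.mpr hn).ne']
  e_perp := by
    rw [real_inner_smul_left, inner_fin_three]
    simp only [Torus.latticeVec_apply]
    have := h.2.2.2.1
    have h' : (d.v 0 : ℝ) * d.m 0 + d.v 1 * d.m 1 + d.v 2 * d.m 2 = 0 := by exact_mod_cast this
    rw [h', mul_zero]
  τ_pos := by exact_mod_cast h.2.2.2.2

/-- The per-slot closed form this file uses (depends on the slot data and on `q`, `p` only through coordinates). -/
def slotTerm (d : SlotData) (q p : EuclideanSpace ℝ (Fin 3)) : ℝ :=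
  (d.τ : ℝ) * ((d.v 0 : ℝ) * q 0 + d.v 1 * q 1 + d.v 2 * q 2) ^ 2 *
      (((d.m 0 : ℝ) ^ 2 + d.m 1 ^ 2 + d.m 2 ^ 2) - (p 0 * d.m 0 + p 1 * d.m 1 + p 2 * d.m 2) ^ 2) /
    (2 * (2 * π) ^ 4 * d.n * ((d.m 0 : ℝ) ^ 2 + d.m 1 ^ 2 + d.m 2 ^ 2) ^ 3)

/-- Pure algebra behind `slotGain_mkPhase`. -/
theorem slot_algebra (τ r M sn n S Smp Smq Spq c : ℝ) (hr : r ^ 2 = M) (hM : 0 < M) (hsn : sn ^ 2 = n)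
    (hn : 0 < n) (hpq : Spq = 0) (hc : 0 < c) :
    τ * (1 / (2 * (c * r) ^ 4)) * ((1 / sn) * S) ^ 2 * (1 ^ 2 - ((1 / r) * Smp - (1 / r) * Smq * Spq) ^ 2) =
      τ * S ^ 2 * (M - Smp ^ 2) / (2 * c ^ 4 * n * M ^ 3) := by
  subst hpq
  have hr0 : r ≠ 0 := by rintro rfl; simp at hr; linarith
  have hsn0 : sn ≠ 0 := by rintro rfl; simp at hsn; linarith
  have hr4 : r ^ 4 = M ^ 2 := by rw [← hr]; ring
  have e1 : (c * r) ^ 4 = c ^ 4 * M ^ 2 := by rw [mul_pow, hr4]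
  have e2 : ((1 / sn) * S) ^ 2 = S ^ 2 / n := by rw [mul_pow, one_div, inv_pow, hsn]; ring
  have e3 : ((1 / r) * Smp - (1 / r) * Smq * 0) ^ 2 = Smp ^ 2 / M := by
    rw [mul_zero, sub_zero, mul_pow, one_div, inv_pow, hr]; ring
  rw [e1, e2, e3]
  field_simp

/-- LEMMA C: the slot gain of an admissible slot at unit `p ⊥ q`, in coordinates. -/
theorem slotGain_mkPhase (d : SlotData) (h : d.ok) (q p : EuclideanSpace ℝ (Fin 3)) (hp : ‖p‖ = 1)
    (hpq : ⟪p, q⟫_ℝ = 0) : slotGain (mkPhase d h) q p = slotTerm d q p := by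
  have hn : (0 : ℝ) < d.n := by exact_mod_cast h.2.1
  have hM2 : ‖Torus.latticeVec d.m‖ ^ 2 = (d.m 0 : ℝ) ^ 2 + d.m 1 ^ 2 + d.m 2 ^ 2 := by
    rw [norm_sq_fin_three]; simp only [Torus.latticeVec_apply]
  set M : ℝ := (d.m 0 : ℝ) ^ 2 + d.m 1 ^ 2 + d.m 2 ^ 2 with hMdef
  have hMpos : 0 < M := by
    rcases h.1 with h0 | h0 | h0
    · have : (0:ℝ) < (d.m 0 : ℝ) ^ 2 := by
        have : (d.m 0 : ℝ) ≠ 0 := by exact_mod_cast h0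
        positivity
      nlinarith [sq_nonneg (d.m 1 : ℝ), sq_nonneg (d.m 2 : ℝ)]
    · have : (0:ℝ) < (d.m 1 : ℝ) ^ 2 := by
        have : (d.m 1 : ℝ) ≠ 0 := by exact_mod_cast h0
        positivity
      nlinarith [sq_nonneg (d.m 0 : ℝ), sq_nonneg (d.m 2 : ℝ)]
    · have : (0:ℝ) < (d.m 2 : ℝ) ^ 2 := by
        have : (d.m 2 : ℝ) ≠ 0 := by exact_mod_cast h0
        positivity
      nlinarith [sq_nonneg (d.m 0 : ℝ), sq_nonneg (d.m 1 : ℝ)]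
  have h1 : ⟪(1 / Real.sqrt d.n) • Torus.latticeVec d.v, q⟫_ℝ =
      (1 / Real.sqrt d.n) * ((d.v 0 : ℝ) * q 0 + d.v 1 * q 1 + d.v 2 * q 2) := by
    rw [real_inner_smul_left, inner_fin_three]; simp only [Torus.latticeVec_apply]
  have h2 : ⟪p, (1 / ‖Torus.latticeVec d.m‖) • Torus.latticeVec d.m -
      ⟪(1 / ‖Torus.latticeVec d.m‖) • Torus.latticeVec d.m, q⟫_ℝ • q⟫_ℝ =
      (1 / ‖Torus.latticeVec d.m‖) * (p 0 * d.m 0 + p 1 * d.m 1 + p 2 * d.m 2) -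
        (1 / ‖Torus.latticeVec d.m‖) * ((d.m 0 : ℝ) * q 0 + d.m 1 * q 1 + d.m 2 * q 2) * ⟪p, q⟫_ℝ := by
    rw [inner_sub_right, real_inner_smul_right, real_inner_smul_right, real_inner_smul_left,
      inner_fin_three p, inner_fin_three (Torus.latticeVec d.m)]
    simp only [Torus.latticeVec_apply]
  show (d.τ : ℝ) * (1 / (2 * (2 * π * ‖Torus.latticeVec d.m‖) ^ 4)) *
      ⟪(1 / Real.sqrt d.n) • Torus.latticeVec d.v, q⟫_ℝ ^ 2 *
      (‖p‖ ^ 2 - ⟪p, (1 / ‖Torus.latticeVec d.m‖) • Torus.latticeVec d.m -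
        ⟪(1 / ‖Torus.latticeVec d.m‖) • Torus.latticeVec d.m, q⟫_ℝ • q⟫_ℝ ^ 2) = slotTerm d q p
  rw [h1, h2, hp]
  unfold slotTerm
  rw [← hMdef]
  exact slot_algebra (d.τ : ℝ) ‖Torus.latticeVec d.m‖ M (Real.sqrt d.n) d.n _ _ _ _ (2 * π) hM2 hMpos
    (Real.sq_sqrt hn.le) hn hpq (by positivity)

/-- The 26 slots: 13 directions × 2 polarisations; `τ = c |m|⁴` with `c = 40, 32, 27` for axes, face and body diagonals. -/
def slots : Fin 26 → SlotData :=
  ![⟨![1, 0, 0], ![0, 1, 0], 1, 40⟩, ⟨![1, 0, 0], ![0, 0, 1], 1, 40⟩,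
    ⟨![0, 1, 0], ![1, 0, 0], 1, 40⟩, ⟨![0, 1, 0], ![0, 0, 1], 1, 40⟩,
    ⟨![0, 0, 1], ![1, 0, 0], 1, 40⟩, ⟨![0, 0, 1], ![0, 1, 0], 1, 40⟩,
    ⟨![1, 1, 0], ![0, 0, 1], 1, 128⟩, ⟨![1, 1, 0], ![1, -1, 0], 2, 128⟩,
    ⟨![1, -1, 0], ![0, 0, 1], 1, 128⟩, ⟨![1, -1, 0], ![1, 1, 0], 2, 128⟩,
    ⟨![1, 0, 1], ![0, 1, 0], 1, 128⟩, ⟨![1, 0, 1], ![1, 0, -1], 2, 128⟩,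
    ⟨![1, 0, -1], ![0, 1, 0], 1, 128⟩, ⟨![1, 0, -1], ![1, 0, 1], 2, 128⟩,
    ⟨![0, 1, 1], ![1, 0, 0], 1, 128⟩, ⟨![0, 1, 1], ![0, 1, -1], 2, 128⟩,
    ⟨![0, 1, -1], ![1, 0, 0], 1, 128⟩, ⟨![0, 1, -1], ![0, 1, 1], 2, 128⟩,
    ⟨![1, 1, 1], ![1, -1, 0], 2, 243⟩, ⟨![1, 1, 1], ![1, 1, -2], 6, 243⟩,
    ⟨![1, 1, -1], ![1, -1, 0], 2, 243⟩, ⟨![1, 1, -1], ![1, 1, 2], 6, 243⟩,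
    ⟨![1, -1, 1], ![1, 1, 0], 2, 243⟩, ⟨![1, -1, 1], ![1, -1, -2], 6, 243⟩,
    ⟨![1, -1, -1], ![1, 1, 0], 2, 243⟩, ⟨![1, -1, -1], ![1, -1, 2], 6, 243⟩]

/-- Every slot is admissible (integer arithmetic, by `decide`). -/
theorem slots_ok : ∀ j : Fin 26, (slots j).ok := by
  unfold SlotData.ok; decide

/-- The 26-slot isotropic cubature word (ramp `1/2`). -/
def cubatureWord : LatticeWord 26 where
  phase j := mkPhase (slots j) (slots_ok j)
  ramp := 1 / 2
  pos := by norm_num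
  ramp_pos := by norm_num
  ramp_le := le_refl _

/-- The exact Taylor constant of the cubature word. -/
def c0 : ℝ := 7 / (4960 * π ^ 4)

/-- `c0 > 0`. -/
theorem c0_pos : 0 < c0 := by unfold c0; positivity

/-- The period is `2 · (3·40 + 6·128 + 4·243) = 3720`. -/
theorem period_cubatureWord : cubatureWord.period = 3720 := by
  simp only [LatticeWord.period, cubatureWord, mkPhase, slots]
  simp only [Fin.sum_univ_succ, Fin.sum_univ_zero, Matrix.cons_val_zero, Matrix.cons_val_succ]
  norm_num

/-- The slot sum as a POLYNOMIAL in the coordinates of `q`, `p` (frame completeness + cubature moments, by `ring`). -/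
theorem slotTerm_sum (q p : EuclideanSpace ℝ (Fin 3)) :
    ∑ j, slotTerm (slots j) q p =
      (280 * (q 0 ^ 2 + q 1 ^ 2 + q 2 ^ 2) - 112 * (q 0 ^ 2 + q 1 ^ 2 + q 2 ^ 2) * (p 0 ^ 2 + p 1 ^ 2 + p 2 ^ 2)
        + 56 * (p 0 * q 0 + p 1 * q 1 + p 2 * q 2) ^ 2) / (32 * π ^ 4) := by
  simp only [Fin.sum_univ_succ, Fin.sum_univ_zero, slots, slotTerm, Matrix.cons_val_zero, Matrix.cons_val_succ,
    Matrix.cons_val_one, Matrix.head_cons, Matrix.cons_val_two, Matrix.tail_cons]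
  push_cast
  field_simp
  ring

/-- MAIN: the cubature word is isotropic with Taylor constant `c0 = 7/(4960 π⁴)`. -/
theorem isotropicWordGain_cubatureWord : IsotropicWordGain cubatureWord c0 := by
  intro q p hq hp hpq
  have hA : q 0 ^ 2 + q 1 ^ 2 + q 2 ^ 2 = 1 := by rw [← norm_sq_fin_three, hq]; norm_num
  have hB : p 0 ^ 2 + p 1 ^ 2 + p 2 ^ 2 = 1 := by rw [← norm_sq_fin_three, hp]; norm_num
  have hC : p 0 * q 0 + p 1 * q 1 + p 2 * q 2 = 0 := by rw [← inner_fin_three]; exact hpq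
  have key : ∑ j, slotGain (cubatureWord.phase j) q p = ∑ j, slotTerm (slots j) q p :=
    Finset.sum_congr rfl fun j _ => slotGain_mkPhase (slots j) (slots_ok j) q p hp hpq
  rw [key, slotTerm_sum, hA, hB, hC, period_cubatureWord]
  unfold c0
  field_simp
  norm_num

/-- The registered stub `stub_isotropicDesign` of the K2Q skeleton, PROVED. -/
theorem isotropicDesign_exists :
    ∃ k, ∃ W : LatticeWord k, ∃ c₀ > (0:ℝ), IsotropicWordGain W c₀ :=
  ⟨26, cubatureWord, c0, c0_pos, isotropicWordGain_cubatureWord⟩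

end

end Summit.AnomalousDissipation.AnomalousDissipation.Theorems
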